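import Literature.AlgebraicGeometry.HodgeTheory.DirectImageTransport
import HarnessLib

/-!
# Transport in `Rᵏ π_* ℂ` is compatible with shrinking the locally trivial open set

Family `hodge`, layer `Literature/AlgebraicGeometry/HodgeTheory`. A bookkeeping complement to
`DirectImageTransport`: for `π : 𝒳 ⟶ S` and two cohomologically locally trivial subsets
`V ⊆ U` of `S(ℂ)` (e.g. `V` an open subset of `U`, `IsCohomologicallyLocallyTrivialOn.mono`), the
parallel transport `transportFun π k hV ⟦p⟧` along a path `p` of `V` coincides with the transport
`transportFun π k hU ⟦ι ∘ p⟧` along the same path viewed in `U` (`ι : V ↪ U` the inclusion).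
Both are endpoints of lifts of the same path of `S(ℂ)` to the espace étalé `FiberClass π k`, so this
is uniqueness of lifts (`transportFun_eq_of_path` / `exists_path_transportFun`).

* `transportFun_map_inclusion` — path form; `transportFun_map_inclusion'` — homotopy-class form
  (`Path.Homotopic.Quotient.map` along the inclusion);
* `transportFun_map_inclusion_univ` / `transportFun_map_inclusion_univ'` — the case `U = univ`
  (transport for a family locally trivial over all of `S(ℂ)`, read on a smaller open piece).

Used by the (U)-road of cell hodgecm-mathlib (U-e P4: Griffiths frames are stated over `Set.univ`,
flat integral frames over a chart ball `W`). Nothing here is specific to that consumer.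

## References

* [VoisinHodgeI2002] C. Voisin, Hodge Theory and Complex Algebraic Geometry I, CUP 2002, §9.2.1.
* [HatcherAT2002] A. Hatcher, Algebraic Topology, CUP 2002, §1.3 Prop. 1.34.
-/

noncomputable section

open CategoryTheory AlgebraicGeometry
open _root_.Topology
open Literature.AlgebraicTopology.SingularHomology

namespace Literature.AlgebraicGeometry.HodgeTheory

variable {𝒳 S : Motives.SchemeOver ℂ} (π : 𝒳 ⟶ S) (k : ℕ) {U V : Set (Motives.ComplexPoints S)}
  (hU : IsCohomologicallyLocallyTrivialOn π U) (hV : IsCohomologicallyLocallyTrivialOn π V) (hVU : V ⊆ U)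

/-- **Transport is compatible with shrinking the locally trivial set (path form).** For `V ⊆ U` both
cohomologically locally trivial and a path `p` in `V`, transport along `p` computed in `V` equals
transport along `ι ∘ p` computed in `U` (uniqueness of lifts to the espace étalé).
[cite: VoisinHodgeI2002, §9.2.1] [cite: HatcherAT2002, §1.3 Prop. 1.34] -/
theorem transportFun_map_inclusion {s t : V} (p : Path s t)
    (α : complexBetti (Motives.fiberOver π s.1) k) :
    transportFun π k hU ⟦p.map (continuous_inclusion hVU)⟧ α = transportFun π k hV ⟦p⟧ α := by
  obtain ⟨Γ, hΓ⟩ := exists_path_transportFun π k hV p α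
  exact transportFun_eq_of_path π k hU (p.map (continuous_inclusion hVU)) Γ fun u ↦ hΓ u

/-- **Transport is compatible with shrinking the locally trivial set (homotopy-class form).**
[cite: VoisinHodgeI2002, §9.2.1] [cite: HatcherAT2002, §1.3 Prop. 1.34] -/
theorem transportFun_map_inclusion' {s t : V} (γ : Path.Homotopic.Quotient s t)
    (α : complexBetti (Motives.fiberOver π s.1) k) :
    transportFun π k hU (γ.map ⟨Set.inclusion hVU, continuous_inclusion hVU⟩) α =
      transportFun π k hV γ α := by
  induction γ using Quotient.ind with
  | _ p => exact transportFun_map_inclusion π k hU hV hVU p α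

omit hVU in
/-- The case `U = S(ℂ)`: transport for a family cohomologically locally trivial over all of `S(ℂ)`,
along a path of a smaller locally trivial piece `V`, read in `V` (path form).
[cite: VoisinHodgeI2002, §9.2.1] -/
theorem transportFun_map_inclusion_univ (hU : IsCohomologicallyLocallyTrivialOn π Set.univ) {s t : V}
    (p : Path s t) (α : complexBetti (Motives.fiberOver π s.1) k) :
    transportFun π k hU ⟦p.map (continuous_inclusion (Set.subset_univ V))⟧ α =
      transportFun π k hV ⟦p⟧ α :=
  transportFun_map_inclusion π k hU hV (Set.subset_univ V) p α

omit hVU in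
/-- The case `U = S(ℂ)` (homotopy-class form). [cite: VoisinHodgeI2002, §9.2.1] -/
theorem transportFun_map_inclusion_univ' (hU : IsCohomologicallyLocallyTrivialOn π Set.univ) {s t : V}
    (γ : Path.Homotopic.Quotient s t) (α : complexBetti (Motives.fiberOver π s.1) k) :
    transportFun π k hU (γ.map ⟨Set.inclusion (Set.subset_univ V), continuous_inclusion (Set.subset_univ V)⟩) α =
      transportFun π k hV γ α :=
  transportFun_map_inclusion' π k hU hV (Set.subset_univ V) γ α

end Literature.AlgebraicGeometry.HodgeTheory

end
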